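import Literature.NumberTheory.Sieve.FordMaynardConstruction
import Literature.NumberTheory.Sieve.FordMaynardTweak
import Literature.Barriers.Parity.FordMaynardPrimeSievesMinimalTypeIIProofs
import HarnessLib

/-!
# Ford–Maynard, Theorem 9.1 and Theorem 2.1: the discharges

Discharge of the named facts `Literature.Barriers.Parity.FordMaynardPrimeFreeOfTypeIStar`
(K. Ford, J. Maynard, *On the theory of prime producing sieves*, arXiv:2407.14368, Theorem 9.1) and,
through `FordMaynardMinimalTypeII_of_primeFree`, of the catalogue entry
`Literature.Barriers.Parity.FordMaynardMinimalTypeII` (Theorem 2.1, the minimal Type-II range).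
Everything here is PROVED. The proof of Theorem 9.1 combines

* the analytic half (`FordMaynardTweak.lean`): from `f ∈ 𝔉*_η(γ)` with `f(1) = −1 − δ`,
  `f ≥ −1` in dimensions `≥ 2`, and parameters `(θ, ν)`, `ε`, the tweaked function
  `h = tweak γ η lo w f` (cut `f` off at vectors with a nonempty proper subsum in
  `[γ−ε, γ+ε] ∪ [θ−ε, θ+ν+ε]`, re-extend by the fragmentation relation) lies in `𝒮`, is piecewise
  Lipschitz, satisfies (TypeI-f), vanishes at bad vectors, and is within `C (ν + 4ε)` of `f` at
  good vectors ((f-ftilde), (fh1));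
* the arithmetic half (`FordMaynardConstruction.lean`, Theorem 6.3 (a) made exact): such an `h`
  with `z = h(1) < −1 ≤ …` yields prime-free admissible sequences for every `B`;

with `ε` and `ν₀` chosen so that `C(ν₀ + 4ε) ≤ δ/2`.

## References

* K. Ford, J. Maynard, *On the theory of prime producing sieves*, arXiv:2407.14368v1 (2024),
  Theorem 2.1, Theorem 6.3 (a), Theorem 9.1 and their proofs (§§6.2, 9). [FordMaynard2024PrimeSieves]
-/

noncomputable section

open Finset
open Literature.NumberTheory.Sieve Literature.NumberTheory.Sieve.FordMaynard

namespace Literature.Barriers.Parity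

/-- **Ford–Maynard, Theorem 9.1** (discharge of `FordMaynardPrimeFreeOfTypeIStar`).
[cite: FordMaynard2024PrimeSieves, Theorem 9.1] -/
theorem FordMaynardPrimeFreeOfTypeIStar_holds : FordMaynardPrimeFreeOfTypeIStar := by
  intro γ hγ hγ1 hex
  obtain ⟨η, hη0, hηγ, f, hf, hf1, hf2⟩ := hex
  have hγ0 : 0 < γ := by linarith
  have hη1 : η ≤ 1 := by linarith
  set δ : ℝ := -1 - f 1 (fun _ => 1) with hδ
  have hδ0 : 0 < δ := by rw [hδ]; linarith
  obtain ⟨F, hF⟩ := hf.bounded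
  have hF0 : 0 ≤ F := (abs_nonneg _).trans (hF 0 fun i => i.elim0)
  -- the constant of the closeness bound, uniformly in the dimension `m ≤ ⌊1/η⌋`
  set N : ℕ := maxBlock η with hN
  set Kmax : ℕ := ⌊1 / η⌋₊ with hKmax
  set Cm : ℕ → ℝ := fun m => (N : ℝ) ^ m * ((N * (2 ^ N) ^ N / η ^ N) ^ m * F) *
    ((2 : ℝ) ^ (m * N) * (2 * (1 + m) ^ (m * N - 1))) with hCm
  have hCm0 : ∀ m, 0 ≤ Cm m := fun m => by rw [hCm]; positivity
  set C : ℝ := ∑ m ∈ Finset.range (Kmax + 1), Cm m with hC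
  have hC0 : 0 ≤ C := Finset.sum_nonneg fun m _ => hCm0 m
  have hCle : ∀ m, m ≤ Kmax → Cm m ≤ C := fun m hm =>
    Finset.single_le_sum (fun m _ => hCm0 m) (Finset.mem_range.2 (Nat.lt_succ_of_le hm))
  -- the choice of `ε` and `ν₀`
  set ε : ℝ := min 1 (δ / (16 * (C + 1))) with hε
  have hε0 : 0 < ε := by rw [hε]; positivity
  have hε1 : ε ≤ 1 := min_le_left _ _
  have hεδ : 4 * ε * (C + 1) ≤ δ / 4 := by
    have : ε ≤ δ / (16 * (C + 1)) := min_le_right _ _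
    rw [le_div_iff₀ (by positivity)] at this
    linarith
  refine ⟨min (1 / 2) (δ / (4 * (C + 1))), by positivity, ?_⟩
  intro θ ν B hθ0 hθ hν0 _ hνν₀ _
  have hν2 : ν ≤ 1 / 2 := hνν₀.trans (min_le_left _ _)
  have hνδ : ν * (C + 1) ≤ δ / 4 := by
    have : ν ≤ δ / (4 * (C + 1)) := hνν₀.trans (min_le_right _ _)
    rw [le_div_iff₀ (by positivity)] at this
    linarith
  have hθν : θ + ν < 1 := by linarith
  -- the tweaked function: bad intervals `[γ−ε, γ+ε]` (index `0`) and `[θ−ε, θ+ν+ε]` (index `1`)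
  set lo : Fin 2 → ℝ := fun l => if l = 0 then γ - ε else θ - ε with hlo
  set wd : Fin 2 → ℝ := fun l => if l = 0 then 2 * ε else ν + 2 * ε with hwd
  have hwd0 : ∀ l, 0 ≤ wd l := fun l => by
    rw [hwd]; simp only []; split_ifs <;> linarith
  set h : VecFn := tweak γ η lo wd f with hh
  have hsupp_f : ∀ (k : ℕ) (ξ : Fin k → ℝ), f k ξ ≠ 0 → (∀ i, η ≤ ξ i) ∧ ∑ i, ξ i = 1 := hf.support
  have hsym : h.IsSymmetric := isSymmetric_tweak hf.symm
  have hpl : ∀ k, IsPiecewiseLipschitz (h k) := isPiecewiseLipschitz_tweak hγ0 hγ1 hη0 hf.piecewiseLipschitz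
  obtain ⟨Hb, -, hHb⟩ := exists_bound_tweak (lo := lo) (wd := wd) hγ0 hγ1 hη0 hf.piecewiseLipschitz
  have htypeI : TypeIIdentity γ h := typeIIdentity_tweak hγ0 hγ1 hη0 hη1 hf.symm hf.piecewiseLipschitz hsupp_f
  have hsupp : ∀ (k : ℕ) (v : Fin k → ℝ), h k v ≠ 0 → ∀ i, η ≤ v i := fun k v hv => (tweak_support hv).1
  have hvan : ∀ k, Kmax < k → ∀ v, h k v = 0 := fun k hk v =>
    tweak_eq_zero_of_lt hη0 (Nat.lt_of_floor_lt hk) v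
  have h0 : ∀ v, h 0 v = 0 := fun v => tweak_zero v
  -- vanishing on the two bad intervals
  have hbad_of : ∀ (k : ℕ) (v : Fin k → ℝ) (A : Finset (Fin k)) (l : Fin 2), A.Nonempty → A ≠ Finset.univ →
      lo l ≤ ∑ i ∈ A, v i → ∑ i ∈ A, v i ≤ lo l + wd l → h k v = 0 := fun k v A l hAne hAuniv h1 h2 =>
    tweak_eq_zero_of_badSubsum ⟨A, hAne, hAuniv, l, h1, h2⟩
  have hγv : ∀ (k : ℕ) (v : Fin k → ℝ) (A : Finset (Fin k)), A.Nonempty → A ≠ Finset.univ →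
      γ - ε ≤ ∑ i ∈ A, v i → ∑ i ∈ A, v i ≤ γ + ε → h k v = 0 := by
    intro k v A hAne hAuniv h1 h2
    refine hbad_of k v A 0 hAne hAuniv ?_ ?_
    · show (if (0 : Fin 2) = 0 then γ - ε else θ - ε) ≤ _; rw [if_pos rfl]; exact h1
    · show _ ≤ (if (0 : Fin 2) = 0 then γ - ε else θ - ε) + (if (0 : Fin 2) = 0 then 2 * ε else ν + 2 * ε)
      rw [if_pos rfl, if_pos rfl]; linarith
  have hθv : ∀ (k : ℕ) (v : Fin k → ℝ) (A : Finset (Fin k)), A.Nonempty → A ≠ Finset.univ →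
      θ - ε ≤ ∑ i ∈ A, v i → ∑ i ∈ A, v i ≤ θ + ν + ε → h k v = 0 := by
    intro k v A hAne hAuniv h1 h2
    have h10 : (1 : Fin 2) ≠ 0 := by decide
    refine hbad_of k v A 1 hAne hAuniv ?_ ?_
    · show (if (1 : Fin 2) = 0 then γ - ε else θ - ε) ≤ _; rw [if_neg h10]; exact h1
    · show _ ≤ (if (1 : Fin 2) = 0 then γ - ε else θ - ε) + (if (1 : Fin 2) = 0 then 2 * ε else ν + 2 * ε)
      rw [if_neg h10, if_neg h10]; linarith
  -- closeness to `f` at good vectors, with the constant `C`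
  have hsumwd : ∑ l, wd l = ν + 4 * ε := by
    rw [hwd, Fin.sum_univ_two]; simp; ring
  have hCbound : C * (ν + 4 * ε) ≤ δ / 2 := by nlinarith
  have hclose : ∀ (m : ℕ) (ξ : Fin m → ℝ), m ≤ Kmax → (∀ i, η ≤ ξ i) → ∑ i, ξ i = 1 →
      ¬ BadSubsum lo wd m ξ → |h m ξ - f m ξ| ≤ δ / 2 := by
    intro m ξ hm hξ hsum hgood
    have hb := abs_tweak_sub_le (lo := lo) (wd := wd) hf hη0 hη1 hγ1 hF hwd0 hξ hsum hgood
    rw [hsumwd] at hb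
    calc |h m ξ - f m ξ| ≤ Cm m * (ν + 4 * ε) := by
          refine hb.trans (le_of_eq ?_); rw [hCm, hN]; ring
      _ ≤ C * (ν + 4 * ε) := mul_le_mul_of_nonneg_right (hCle m hm) (by linarith)
      _ ≤ δ / 2 := hCbound
  -- the value on primes
  have hK1 : 1 ≤ Kmax := by
    rw [hKmax]; exact Nat.le_floor (by rw [Nat.cast_one, le_div_iff₀ hη0]; linarith)
  have hgood1 : ¬ BadSubsum lo wd 1 (fun _ : Fin 1 => (1 : ℝ)) := by
    rintro ⟨A, hAne, hAuniv, -⟩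
    apply hAuniv
    obtain ⟨t, ht⟩ := hAne
    ext s
    simp only [Finset.mem_univ, iff_true]
    rwa [Subsingleton.elim s t]
  have hz : h 1 (fun _ => 1) < -1 := by
    have := hclose 1 (fun _ => 1) hK1 (fun _ => hη1) (by simp) hgood1
    rw [abs_le] at this
    linarith [this.2]
  have hlow : ∀ k, 2 ≤ k → ∀ v, h 1 (fun _ => 1) ≤ h k v := by
    intro k hk v
    by_cases hv : h k v = 0
    · rw [hv]; linarith
    · have hkK : k ≤ Kmax := by
        by_contra hlt; exact hv (hvan k (not_le.1 hlt) v)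
      obtain ⟨hge, hsum⟩ := tweak_support hv
      have hgood : ¬ BadSubsum lo wd k v := fun hb => hv (tweak_eq_zero_of_badSubsum hb)
      have h1 := hclose k v hkK hge hsum hgood
      have h2 := hclose 1 (fun _ => 1) hK1 (fun _ => hη1) (by simp) hgood1
      rw [abs_le] at h1 h2
      have := hf2 k hk v
      linarith [h1.1, h2.2]
  exact primeFreeAdmissible_of_vecFn hsym hη0 hη1 hγ0 hγ1 hθ0 hν0.le hθν hε0 hε1 hsupp hHb hpl
    htypeI hvan h0 hγv hθv hz hlow B

/-- **Ford–Maynard, Theorem 2.1 (minimal Type-II range)** — discharge of the catalogue entry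
`FordMaynardMinimalTypeII`. [cite: FordMaynard2024PrimeSieves, Theorem 2.1] -/
theorem FordMaynardMinimalTypeII_holds : FordMaynardMinimalTypeII :=
  FordMaynardMinimalTypeII_of_primeFree FordMaynardPrimeFreeOfTypeIStar_holds

end Literature.Barriers.Parity
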